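import Summits.QuantumFields.YangMills.Theorems.UnitScaleTiltFluctuationComparisonRegPrGlobalSlackKernelRescaleTransfer
import HarnessLib

/-!
# `UnitScaleTiltFluctuationComparisonRegPrGlobalSlackKernelRescaleHonest` — THE COLLAR POLYLOGARITHM IS PAID BY THE BIRTH COUPLING, III: the displayed chart row with its
# coupling ⟹ `KernelSizeΦg` and the honest Taylor rest; the HONEST K1a line ⟹ the K1a line of record ⟹ the registered text of 3⁗ (crux `FluctuationComparisonRegPrL`,
# stmt-QuantumFields-19935, STUB 3⁗ `stub_globalTwoRunSlackFam`; lane A)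

PORT (prover seat ym-ust-19935-slack g0) of ym-cruxidea-19201-1 g14's crux sketch `Cruxes/FluctuationComparisonRegPr/Sketch_ideator1_g14.lean` (sha16 196e545072150834, F-idea1-g14-1, farm rc 0), namespace `Summit.QuantumFields.YangMills.Theorems.GlobalSlackKernelRescale`; statements and proofs verbatim, split in three files.

* §5 `gCoFam` (= run `K`'s `S.gk b`, `gCoFam_eq_gk`; `collarW_eq_rFun_gk` = `bound28`'s factor), `norm_kerT_le`, `kernelSizeΦg_of_chartAnalyticG` (from the slack pen's keep-`g`
  rider `ChartAnalyticGΦ`, p532839), `taylorRest_arith_r`, `remainderSmallΦ_taylorRest_honest` (K-uniform honest window), `polymerCauchyMinAtTSlack_of_displayed_honest(_g)`;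
* §6 **`K1aLineHonest L 𝔠 a₀ a₁ a`** (the slack pen's `K1aLine` with the three display-located rows honest), **`k1aLine_of_honest : K1aLineHonest … a → K1aLine … (a(1−t))`**,
  **`globalTwoRunSlackFam_of_k1aLineHonest`**: ⟨the registered text of `stub_globalTwoRunSlackFam` verbatim⟩ from the honest line (`t = ½`).
Nothing of [Balaban1985UV3]/[King1986] is asserted.

References: T. Bałaban, CMP 102 (1985) 255–275 [Balaban1985UV3] ((7) p.257, (28) p.263, (34) p.264, (39) p.266); C. King, CMP 102 (1986) 649–677 [King1986] (Thm 3.4 (3.9)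
p.656, Prop. 3.6 (3.55)–(3.56) p.662, Prop. 3.9 (3.71)–(3.74) p.665).
-/

noncomputable section

open scoped BigOperators
open Literature.MathematicalPhysics.QuantumFieldTheory.Balaban1983to89
open Literature.MathematicalPhysics.QuantumFieldTheory.Balaban1983to89.T3ContinuumYM3Torus
open Literature.MathematicalPhysics.QuantumFieldTheory.Balaban1983to89.T3UnitScaleTilt
open Literature.MathematicalPhysics.QuantumFieldTheory.Balaban1983to89.T3LevelShift
open Literature.MathematicalPhysics.QuantumFieldTheory.Balaban1983to89.T3AlphaInputsAC
open Literature.MathematicalPhysics.QuantumFieldTheory.Balaban1983to89.T3AlphaPolymerSocket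
open Literature.MathematicalPhysics.QuantumFieldTheory.Balaban1983to89.T3AlphaInputsACTwoRun
open Literature.MathematicalPhysics.QuantumFieldTheory.Balaban1983to89.T3AlphaInputsACTwoRunLevel
open Literature.MathematicalPhysics.QuantumFieldTheory.Balaban1985CMP102.Binders (ChartAnalyticityAsCited)
open Summit.QuantumFields.Balaban3D.Carriers
open Summit.QuantumFields.Balaban3D.Proofs.Primitives
open Summit.QuantumFields.Balaban3D.Proofs.GroupModelLieC (lieC)
open Summit.QuantumFields.YangMills.Theorems
open Summit.QuantumFields.YangMills.Theorems.GlobalSlack (GlobalSupRateTSlack)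
open Summit.QuantumFields.Balaban3D.Proofs.Representation33 (jet26)
open Summit.QuantumFields.YangMills.Theorems.GlobalSlackKernelMatching

namespace Summit.QuantumFields.YangMills.Theorems.GlobalSlackKernelRescale

section Displayed

variable {𝕍 : Type} [NormedAddCommGroup 𝕍] [NormedSpace ℂ 𝕍] {F : T3Family} {γ : ℝ}

/-- THE BIRTH-COUPLING PROFILE of a family: `g K b := g_{K-b} = √(γ L^{-(K-b)})` (= run `K`'s `S.gk b` by `gk_eq_gRun_norm` and `T3Scales`, the coupling displayed in G3D-01 `chart : ChartAnalyticityAsCited ((𝔖 b).Ψ Y) ρ (C25 * S.gk b * exp …)`) — the profile at which the slack pen's keep-`g` rows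
`ChartAnalyticGΦ`/`KernelSizeGΦ` (p532839 §2c) are read here (matched charts `(K,b)`/`(K+1,b+1)` share it). [cite: Balaban1985UV3, (3) p.256, (25) p.262] -/
abbrev gCoFam (F : T3Family) (γ : ℝ) : ℕ → ℕ → ℝ := fun K b => gCo F.L γ (K - b)

/-- The birth-coupling profile lies in `[0, 1]` (for `0 < γ ≤ 1`). [cite: Balaban1985UV3, (3) p.256] -/
theorem gCoFam_window (hL : 1 ≤ F.L) (hγ : 0 < γ) (hγ1 : γ ≤ 1) : ∀ K b, 0 ≤ gCoFam F γ K b ∧ gCoFam F γ K b ≤ 1 :=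
  fun _ _ => ⟨(gCo_pos hL hγ _).le, gCo_le_one hL hγ hγ1 _⟩

/-- **THE PROFILE IS THE LANE'S DISPLAYED RUNNING COUPLING**: `gCoFam F γ K b = (T3Scales F γ hγ hγ1 K).gk b` for `b ≤ K` — literally the `S.gk k` of the displayed
row G3D-01 `chart : ChartAnalyticityAsCited ((𝔖 k).Ψ Y) 𝔠.ρ (𝔠.C25 * S.gk k * exp (−𝔠.κ·dj Y))` at the chart's own step `k = b` (g12 (D1) `ChartsDisplayed`).
[cite: Balaban1985UV3, (3)+(5) p.256, (25) p.262] -/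
theorem gCoFam_eq_gk (hγ : 0 < γ) (hγ1 : γ ≤ 1) {K b : ℕ} (hb : b ≤ K) :
    gCoFam F γ K b = (T3Scales F γ hγ hγ1 K).gk b := by
  have hL : (F.L : ℝ) ≠ 0 := by exact_mod_cast (zero_lt_one.trans F.hL.2).ne'
  have hK : (F.L : ℝ) ^ K = (F.L : ℝ) ^ b * (F.L : ℝ) ^ (K - b) := by rw [← pow_add, Nat.add_sub_cancel' hb]
  show Real.sqrt (γ * ((F.L : ℝ)⁻¹) ^ (K - b)) = Real.sqrt γ * Real.sqrt ((F.L : ℝ) ^ b * ((F.L : ℝ)⁻¹) ^ K)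
  rw [← Real.sqrt_mul hγ.le]
  congr 1
  rw [inv_pow, inv_pow, hK, mul_inv, mul_inv_cancel_left₀ (pow_ne_zero b hL)]

/-- **THE COLLAR WEIGHT IS `bound28`'S POLYLOGARITHM**: `collarW F.L γ r₀ (K - j) = rFun r₀ ((T3Scales F γ hγ hγ1 K).gk j)` for `j ≤ K` — literally the factor
`rFun 𝔠.r₀ (S.gk k)` of the displayed row `bound28 : ‖(𝔖 k).Bcfg Y h U‖ ≤ 𝔠.cB * (rFun 𝔠.r₀ (S.gk k) * S.gk k * pFun 𝔠.b₀ 𝔠.p₀ (S.gk k))` at the configuration's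
birth step `k = j` (g12 (D2) `BirthCfgDisplayed`; the slack pen's REPORT-K1a-display-g0 located exactly this factor). [cite: Balaban1985UV3, (7) p.257, (28) p.263] -/
theorem collarW_eq_rFun_gk (hγ : 0 < γ) (hγ1 : γ ≤ 1) (r₀ : ℝ) {K j : ℕ} (hj : j ≤ K) :
    collarW F.L γ r₀ (K - j) = B10.rFun r₀ ((T3Scales F γ hγ hγ1 K).gk j) := by
  show B10.rFun r₀ (gCoFam F γ K j) = _
  rw [gCoFam_eq_gk hγ hγ1 hj]

/-- The transported kernel is bounded by run `K+1`'s kernel (`‖transport‖ ≤ 1`). [cite: King1986, Prop. 3.6 (3.56) p.662] -/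
theorem norm_kerT_le (Φ : ChartFam 𝕍 F) (K b : ℕ) (Y : Set (Site (F.P K) 0)) (d : ℕ) :
    ‖kerT Φ K b Y d‖ ≤ ‖ker Φ (K + 1) (b + 1) (refineSet F K Y) d‖ := by
  have ht : ‖transport 𝕍 F K b‖ ≤ 1 :=
    ContinuousLinearMap.opNorm_le_bound _ zero_le_one fun x => by simpa only [one_mul] using norm_transport_le K b x
  have hprod : ∏ _i : Fin d, ‖transport 𝕍 F K b‖ ≤ 1 :=
    Finset.prod_le_one (fun _ _ => norm_nonneg _) (fun _ _ => ht)
  calc ‖kerT Φ K b Y d‖ ≤ ‖ker Φ (K + 1) (b + 1) (refineSet F K Y) d‖ * ∏ _i : Fin d, ‖transport 𝕍 F K b‖ :=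
        ContinuousMultilinearMap.norm_compContinuousLinearMap_le _ _
    _ ≤ ‖ker Φ (K + 1) (b + 1) (refineSet F K Y) d‖ * 1 := mul_le_mul_of_nonneg_left hprod (norm_nonneg _)
    _ = ‖ker Φ (K + 1) (b + 1) (refineSet F K Y) d‖ := mul_one _

/-- **`KernelSizeΦg` (BOTH RUNS) IS A THEOREM UNDER THE DISPLAYED KEEP-`g` CHART ROW** (step (iii) losslessly: the slack pen's operator-norm Cauchy inequality
`norm_iteratedFDeriv_zero_le_uniform` by name, at the birth-coupling profile; the run-`K+1` clause through `‖kerT‖ ≤ ‖ker_{K+1}‖`):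
`ChartAnalyticGΦ D Φ κ ρ C_A (gCoFam F γ) ⟹ KernelSizeΦg D Φ κ (C_A·(max 1 (12/ρ))⁶)`. [cite: Balaban1985UV3, Prop. 3 (34) p.264; King1986, (3.55) p.662] -/
theorem kernelSizeΦg_of_chartAnalyticG {D : AlphaDataT3 F γ} {Φ : ChartFam 𝕍 F} {κ ρ C_A : ℝ}
    (h : ChartAnalyticGΦ D Φ κ ρ C_A (gCoFam F γ)) : KernelSizeΦg D Φ κ (C_A * (max 1 (12 / ρ)) ^ 6) := by
  intro K k b Y hY d hd
  have hd6 : d ≤ 6 := by have := (Finset.mem_Ico.mp hd).2; omega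
  obtain ⟨h0, h1⟩ := h.2 K k b Y hY
  have e0 := norm_iteratedFDeriv_zero_le_uniform h0 hd6
  have e1 := norm_iteratedFDeriv_zero_le_uniform h1 hd6
  refine ⟨?_, ?_⟩
  · calc ‖ker Φ K b Y d‖ = ‖iteratedFDeriv ℂ d (Φ K b Y) 0‖ := rfl
      _ ≤ C_A * gCo F.L γ (K - b) * Real.exp (-κ * D.treeLen K (1 + b) Y) * (max 1 (12 / ρ)) ^ 6 := e0
      _ = C_A * (max 1 (12 / ρ)) ^ 6 * gCo F.L γ (K - b) * Real.exp (-κ * D.treeLen K (1 + b) Y) := by ring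
  · calc ‖kerT Φ K b Y d‖ ≤ ‖ker Φ (K + 1) (b + 1) (refineSet F K Y) d‖ := norm_kerT_le Φ K b Y d
      _ = ‖iteratedFDeriv ℂ d (Φ (K + 1) (b + 1) (refineSet F K Y)) 0‖ := rfl
      _ ≤ C_A * gCo F.L γ (K - b) * Real.exp (-κ * D.treeLen K (1 + b) Y) * (max 1 (12 / ρ)) ^ 6 := e1
      _ = C_A * (max 1 (12 / ρ)) ^ 6 * gCo F.L γ (K - b) * Real.exp (-κ * D.treeLen K (1 + b) Y) := by ring

/-- The arithmetic of the honest Taylor rest: `2(C_A g e)(2 λ C_s θ x²/ρ)⁷ ≤ (2C_A(2C_s/ρ)⁷ M) e θ⁷ x⁴` when `λ⁷ g ≤ M`, `0 ≤ x ≤ 1`. [folklore] -/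
theorem taylorRest_arith_r {C_A C_s ρ e θ x lam g Mr : ℝ} (hCA : 0 ≤ C_A) (hCs : 0 ≤ C_s) (hρ : 0 < ρ) (he : 0 ≤ e) (hθ : 0 ≤ θ)
    (hx0 : 0 ≤ x) (hx1 : x ≤ 1) (hlam : 0 ≤ lam) (hg : 0 ≤ g) (hMr : lam ^ 7 * g ≤ Mr) :
    2 * (C_A * g * e) * (2 * (lam * (C_s * θ * x ^ 2)) / ρ) ^ 7 ≤ 2 * C_A * (2 * C_s / ρ) ^ 7 * Mr * e * θ ^ 7 * x ^ 4 := by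
  have hx14 : x ^ 14 ≤ x ^ 4 := pow_le_pow_of_le_one hx0 hx1 (by norm_num)
  have heq : 2 * (C_A * g * e) * (2 * (lam * (C_s * θ * x ^ 2)) / ρ) ^ 7 =
      2 * C_A * (2 * C_s / ρ) ^ 7 * (lam ^ 7 * g) * e * θ ^ 7 * x ^ 14 := by ring
  rw [heq]
  have h1 : 0 ≤ 2 * C_A * (2 * C_s / ρ) ^ 7 := by positivity
  have hMr0 : 0 ≤ Mr := le_trans (mul_nonneg (pow_nonneg hlam 7) hg) hMr
  calc 2 * C_A * (2 * C_s / ρ) ^ 7 * (lam ^ 7 * g) * e * θ ^ 7 * x ^ 14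
      ≤ 2 * C_A * (2 * C_s / ρ) ^ 7 * Mr * e * θ ^ 7 * x ^ 14 :=
        mul_le_mul_of_nonneg_right (mul_le_mul_of_nonneg_right
          (mul_le_mul_of_nonneg_right (mul_le_mul_of_nonneg_left hMr h1) he) (pow_nonneg hθ 7)) (pow_nonneg hx0 14)
    _ ≤ 2 * C_A * (2 * C_s / ρ) ^ 7 * Mr * e * θ ^ 7 * x ^ 4 := by
        have hcoef : 0 ≤ 2 * C_A * (2 * C_s / ρ) ^ 7 * Mr * e * θ ^ 7 := by positivity
        exact mul_le_mul_of_nonneg_left hx14 hcoef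

/-- **THE HONEST TAYLOR REST IS A THEOREM UNDER THE DISPLAYED ROWS** (finite-dimensional colour space): `ChartAnalyticGΦ D Φ κ ρ C_A (gCoFam F γ)` (the slack pen's keep-`g` chart row at the birth-coupling profile),
`Deriv1VanishΦ Φ` ((32)), the HONEST configuration size row `CfgSizeΦr D B b₀ p₀ r₀ C_s` ((28) WITH its collar polylogarithm) and the `K`-UNIFORM honest window
`C_s·M(r₀,1)·λ_{n+1} θ(n) ≤ ρ/4` give `RemainderSmallΦ D (taylorRest Φ B) b₀ p₀ κ (2C_A(2C_s/ρ)⁷·M(7r₀,1))` for BOTH runs.  The honest radius `s = λ_{K-j} C_s θ(n) x²`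
is made `K`-uniform by `collarW_add_le` (`λ_{K-j} ≤ λ_{n+1} (1 + log x⁻¹)^{r₀}`, `K-j = (n+1) + (K-n-1-j)`) and `x(1 + log x⁻¹)^{r₀} ≤ M(r₀,1)`; the collar's seventh power is paid by the chart's
coupling, `λ⁷ g_b ≤ M(7r₀,1)`. [cite: Balaban1985UV3, (7) p.257, (28)–(30) p.263, (32) p.264, (57) p.270] -/
theorem remainderSmallΦ_taylorRest_honest [FiniteDimensional ℂ 𝕍] {D : AlphaDataT3 F γ} {Φ : ChartFam 𝕍 F} {B : CfgFam 𝕍 F}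
    {b₀ p₀ κ ρ C_A C_s r₀ : ℝ} (hCA : 0 ≤ C_A) (hCs : 0 ≤ C_s) (hρ : 0 < ρ) (hL : 1 ≤ F.L) (hγ : 0 < γ) (hγ1 : γ ≤ 1) (hr : 0 ≤ r₀)
    (hθ0 : ∀ n, 0 ≤ θBal F.L γ b₀ p₀ n)
    (hwin : ∀ n, C_s * logPowConst r₀ 1 * (collarW F.L γ r₀ (n + 1) * θBal F.L γ b₀ p₀ n) ≤ ρ / 4)
    (hA : ChartAnalyticGΦ D Φ κ ρ C_A (gCoFam F γ)) (h32 : Deriv1VanishΦ Φ) (hS : CfgSizeΦr D B b₀ p₀ r₀ C_s) :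
    RemainderSmallΦ D (taylorRest Φ B) b₀ p₀ κ (2 * C_A * (2 * C_s / ρ) ^ 7 * logPowConst (7 * r₀) 1) := by
  intro K n hn j hj V hV Y hY
  obtain ⟨hA0, hA1⟩ := hA.2 K (K - n) j Y hY
  obtain ⟨hS0, hS1⟩ := hS K n hn j hj V hV Y hY
  have hL' : 1 ≤ (F.L : ℝ) := by exact_mod_cast hL
  have hx0 : 0 < ((F.L : ℝ) ^ (K - n - 1 - j))⁻¹ := by positivity
  have hx1 : ((F.L : ℝ) ^ (K - n - 1 - j))⁻¹ ≤ 1 := inv_le_one_of_one_le₀ (one_le_pow₀ hL')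
  have hlam0 : 0 ≤ collarW F.L γ r₀ (K - j) := (collarW_pos hL hγ hγ1 hr _).le
  have hg0 : 0 ≤ gCo F.L γ (K - j) := (gCo_pos hL hγ _).le
  have he0 : 0 ≤ Real.exp (-κ * D.treeLen K (1 + j) Y) := (Real.exp_pos _).le
  have hcn : 0 ≤ collarW F.L γ r₀ (n + 1) := (collarW_pos hL hγ hγ1 hr (n + 1)).le
  have hs0 : 0 ≤ collarW F.L γ r₀ (K - j) *
      (C_s * θBal F.L γ b₀ p₀ n * (((F.L : ℝ) ^ (K - n - 1 - j))⁻¹) ^ 2) := by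
    have := hθ0 n; positivity
  -- the honest radius is `K`-uniformly inside the window
  have hm : K - j = (n + 1) + (K - n - 1 - j) := by omega
  have hW : collarW F.L γ r₀ (K - j) ≤
      collarW F.L γ r₀ (n + 1) * (1 + Real.log ((((F.L : ℝ) ^ (K - n - 1 - j))⁻¹)⁻¹)) ^ r₀ := by
    have := collarW_add_le hL hγ hγ1 hr (n + 1) (K - n - 1 - j)
    rw [← hm] at this
    exact this
  have hxP : ((F.L : ℝ) ^ (K - n - 1 - j))⁻¹ * (1 + Real.log ((((F.L : ℝ) ^ (K - n - 1 - j))⁻¹)⁻¹)) ^ r₀ ≤ logPowConst r₀ 1 :=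
    mul_logpow_le hx0 hx1 hr
  have hP0 : 0 ≤ (1 + Real.log ((((F.L : ℝ) ^ (K - n - 1 - j))⁻¹)⁻¹)) ^ r₀ :=
    Real.rpow_nonneg (by have := B10.log_inv_nonneg_of_le_one hx0 hx1; linarith) _
  have hsρ : collarW F.L γ r₀ (K - j) *
      (C_s * θBal F.L γ b₀ p₀ n * (((F.L : ℝ) ^ (K - n - 1 - j))⁻¹) ^ 2) ≤ ρ / 4 := by
    have h0 : 0 ≤ C_s * (collarW F.L γ r₀ (n + 1) * θBal F.L γ b₀ p₀ n) := by have := hθ0 n; positivity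
    calc collarW F.L γ r₀ (K - j) * (C_s * θBal F.L γ b₀ p₀ n * (((F.L : ℝ) ^ (K - n - 1 - j))⁻¹) ^ 2)
        ≤ collarW F.L γ r₀ (n + 1) * (1 + Real.log ((((F.L : ℝ) ^ (K - n - 1 - j))⁻¹)⁻¹)) ^ r₀ *
            (C_s * θBal F.L γ b₀ p₀ n * (((F.L : ℝ) ^ (K - n - 1 - j))⁻¹) ^ 2) :=
          mul_le_mul_of_nonneg_right hW (by have := hθ0 n; positivity)
      _ = C_s * (collarW F.L γ r₀ (n + 1) * θBal F.L γ b₀ p₀ n) * ((F.L : ℝ) ^ (K - n - 1 - j))⁻¹ *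
            (((F.L : ℝ) ^ (K - n - 1 - j))⁻¹ * (1 + Real.log ((((F.L : ℝ) ^ (K - n - 1 - j))⁻¹)⁻¹)) ^ r₀) := by ring
      _ ≤ C_s * (collarW F.L γ r₀ (n + 1) * θBal F.L γ b₀ p₀ n) * 1 * logPowConst r₀ 1 :=
          mul_le_mul (mul_le_mul_of_nonneg_left hx1 h0) hxP (mul_nonneg hx0.le hP0) (by rw [mul_one]; exact h0)
      _ = C_s * logPowConst r₀ 1 * (collarW F.L γ r₀ (n + 1) * θBal F.L γ b₀ p₀ n) := by ring
      _ ≤ ρ / 4 := hwin n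
  have hMr : collarW F.L γ r₀ (K - j) ^ 7 * gCo F.L γ (K - j) ≤ logPowConst (7 * r₀) 1 := by
    simpa using collarW_pow_mul_gCo_le' hL hγ hγ1 hr 7 (K - j)
  refine ⟨?_, ?_⟩
  · -- run `K`
    have key := abs_re_taylorRest_le hA0 (h32 K j Y) hs0 hsρ hS0
    exact key.trans (taylorRest_arith_r hCA hCs hρ he0 (hθ0 n) hx0.le hx1 hlam0 hg0 hMr)
  · -- run `K+1`: its configuration is the transport of the pull-back, whose norm the honest size row bounds
    set B₁ : PBond (F.P K) j → 𝕍 := fun c => B (K + 1) (K + 1 - n) (j + 1) (refineSet F K Y)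
      (fieldShift (F.sitesPerDir_eq (m := F.m) (K := K + 1) (j := K + 1 - n) (m' := F.m) (K' := n) (j' := 0) (by omega)) V)
      (matchBond F K j c) with hB₁
    have hpull : B (K + 1) (K + 1 - n) (j + 1) (refineSet F K Y)
        (fieldShift (F.sitesPerDir_eq (m := F.m) (K := K + 1) (j := K + 1 - n) (m' := F.m) (K' := n) (j' := 0) (by omega)) V) =
        transport 𝕍 F K j B₁ := (transport_pullback K j _).symm
    have hB' : ‖B (K + 1) (K + 1 - n) (j + 1) (refineSet F K Y)
        (fieldShift (F.sitesPerDir_eq (m := F.m) (K := K + 1) (j := K + 1 - n) (m' := F.m) (K' := n) (j' := 0) (by omega)) V)‖ ≤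
        collarW F.L γ r₀ (K - j) * (C_s * θBal F.L γ b₀ p₀ n * (((F.L : ℝ) ^ (K - n - 1 - j))⁻¹) ^ 2) := by
      rw [hpull]
      exact (norm_transport_le K j B₁).trans hS1
    have key := abs_re_taylorRest_le hA1 (h32 (K + 1) (j + 1) (refineSet F K Y)) hs0 hsρ hB'
    exact key.trans (taylorRest_arith_r hCA hCs hρ he0 (hθ0 n) hx0.le hx1 hlam0 hg0 hMr)

/-- **ALL SIX INPUT ROWS IN THE DISPLAYED (HONEST) CURRENCY GIVE THE LOCAL SLACK ROW — LOSSLESS `g`-CARRYING K1a**: for the canonical term function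
`termOfCharts Φ B Rfar`, `ChartAnalyticGΦ … (gCoFam F γ)` + `Deriv1VanishΦ` + `FlatKernelCauchyΦg` (K1a with `g`) + `CfgSizeΦr` + `CfgCauchyΦr` + the far row + the two windows
⟹ `PolymerCauchyMinAtTSlack D (termOfCharts Φ B Rfar) b₀ p₀ κ a 7 _` (σ = 7, profile `θBal(b₀,p₀)`).
[cite: Balaban1985UV3, (28)–(30) p.263, (34) p.264, (57) p.270; King1986, Prop. 3.6 (3.56) p.662, Prop. 3.9 (3.71) p.665] -/
theorem polymerCauchyMinAtTSlack_of_displayed_honest_g [FiniteDimensional ℂ 𝕍] {D : AlphaDataT3 F γ} {Φ : ChartFam 𝕍 F} {B : CfgFam 𝕍 F}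
    {Rfar : RemFam F} {b₀ p₀ κ ρ a C_A C C_s C_B C_f r₀ : ℝ}
    (hCA : 0 ≤ C_A) (hC : 0 ≤ C) (hCs : 0 ≤ C_s) (hCB : 0 ≤ C_B) (hCf : 0 ≤ C_f) (hρ : 0 < ρ) (hL : 1 ≤ F.L) (hγ : 0 < γ) (hγ1 : γ ≤ 1)
    (hr : 0 ≤ r₀) (hθ0 : ∀ n, 0 ≤ θBal F.L γ b₀ p₀ n) (hθ1 : ∀ n, (C_s + C_B) * θBal F.L γ b₀ p₀ n ≤ 1)
    (hwin : ∀ n, C_s * logPowConst r₀ 1 * (collarW F.L γ r₀ (n + 1) * θBal F.L γ b₀ p₀ n) ≤ ρ / 4)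
    (hA : ChartAnalyticGΦ D Φ κ ρ C_A (gCoFam F γ)) (h32 : Deriv1VanishΦ Φ) (hK : FlatKernelCauchyΦg D Φ κ a C)
    (hS : CfgSizeΦr D B b₀ p₀ r₀ C_s) (hBC : CfgCauchyΦr D B b₀ p₀ r₀ a C_B fun _ => 1) (hfar : RemainderSmallΦ D Rfar b₀ p₀ κ C_f) :
    PolymerCauchyMinAtTSlack D (termOfCharts Φ B Rfar) b₀ p₀ κ a 7
      (5 * (C_s ^ 2 * (C * logPowConst (6 * r₀) 1) + 6 * C_s * C_B * (C_A * (max 1 (12 / ρ)) ^ 6 * logPowConst (6 * r₀) 1)) +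
        2 * (2 * C_A * (2 * C_s / ρ) ^ 7 * logPowConst (7 * r₀) 1 + C_f)) := by
  have hM7 : 0 ≤ logPowConst (7 * r₀) 1 := (logPowConst_pos (by nlinarith) one_pos).le
  have hCE : 0 ≤ C_A * (max 1 (12 / ρ)) ^ 6 := by positivity
  have hCR : 0 ≤ 2 * C_A * (2 * C_s / ρ) ^ 7 * logPowConst (7 * r₀) 1 + C_f := by positivity
  exact polymerCauchyMinAtTSlack_of_honest_charts_g hC hCE hCR hCs hCB hL hγ hγ1 hr hθ0 hθ1
    (taylorSplit_termOfCharts Φ B Rfar) hK (kernelSizeΦg_of_chartAnalyticG hA)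
    (remainderSmallΦ_add (remainderSmallΦ_taylorRest_honest hCA hCs hρ hL hγ hγ1 hr hθ0 hwin hA h32 hS) hfar) hS hBC

/-- **ALL SIX INPUT ROWS IN THE DISPLAYED (HONEST) CURRENCY GIVE THE LOCAL SLACK ROW — VERBATIM K1a ROW OF RECORD** (no `g` in K1a; interpolation exponent
`0 < t ≤ 1`, rate `a(1-t)`): σ = 7, profile `θBal(b₀,p₀)` — the window profile of 3⁗; no letter of record re-typed.
[cite: Balaban1985UV3, (28)–(30) p.263, (34) p.264, (57) p.270; King1986, Prop. 3.6 (3.56) p.662, Prop. 3.9 (3.71) p.665] -/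
theorem polymerCauchyMinAtTSlack_of_displayed_honest [FiniteDimensional ℂ 𝕍] {D : AlphaDataT3 F γ} {Φ : ChartFam 𝕍 F} {B : CfgFam 𝕍 F}
    {Rfar : RemFam F} {b₀ p₀ κ ρ a C_A C C_s C_B C_f r₀ t : ℝ}
    (hCA : 0 ≤ C_A) (hC : 0 ≤ C) (hCs : 0 ≤ C_s) (hCB : 0 ≤ C_B) (hCf : 0 ≤ C_f) (hρ : 0 < ρ) (hL : 1 ≤ F.L) (hγ : 0 < γ) (hγ1 : γ ≤ 1)
    (hr : 0 ≤ r₀) (ha : 0 ≤ a) (ht : 0 < t) (ht1 : t ≤ 1)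
    (hθ0 : ∀ n, 0 ≤ θBal F.L γ b₀ p₀ n) (hθ1 : ∀ n, (C_s + C_B) * θBal F.L γ b₀ p₀ n ≤ 1)
    (hwin : ∀ n, C_s * logPowConst r₀ 1 * (collarW F.L γ r₀ (n + 1) * θBal F.L γ b₀ p₀ n) ≤ ρ / 4)
    (hA : ChartAnalyticGΦ D Φ κ ρ C_A (gCoFam F γ)) (h32 : Deriv1VanishΦ Φ) (hK : FlatKernelCauchyΦ D Φ κ a C)
    (hS : CfgSizeΦr D B b₀ p₀ r₀ C_s) (hBC : CfgCauchyΦr D B b₀ p₀ r₀ a C_B fun _ => 1) (hfar : RemainderSmallΦ D Rfar b₀ p₀ κ C_f) :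
    PolymerCauchyMinAtTSlack D (termOfCharts Φ B Rfar) b₀ p₀ κ (a * (1 - t)) 7
      (5 * (C_s ^ 2 * (C ^ (1 - t) * (2 * (C_A * (max 1 (12 / ρ)) ^ 6)) ^ t * logPowConst (6 * r₀) t) +
          6 * C_s * C_B * (C_A * (max 1 (12 / ρ)) ^ 6 * logPowConst (6 * r₀) 1)) +
        2 * (2 * C_A * (2 * C_s / ρ) ^ 7 * logPowConst (7 * r₀) 1 + C_f)) := by
  have hM7 : 0 ≤ logPowConst (7 * r₀) 1 := (logPowConst_pos (by nlinarith) one_pos).le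
  have hCE : 0 ≤ C_A * (max 1 (12 / ρ)) ^ 6 := by positivity
  have hCR : 0 ≤ 2 * C_A * (2 * C_s / ρ) ^ 7 * logPowConst (7 * r₀) 1 + C_f := by positivity
  exact polymerCauchyMinAtTSlack_of_honest_charts hC hCE hCR hCs hCB hL hγ hγ1 hr ha ht ht1 hθ0 hθ1
    (taylorSplit_termOfCharts Φ B Rfar) hK (kernelSizeΦg_of_chartAnalyticG hA)
    (remainderSmallΦ_add (remainderSmallΦ_taylorRest_honest hCA hCs hρ hL hγ hγ1 hr hθ0 hwin hA h32 hS) hfar) hS hBC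

end Displayed

/-! ## §6 The honest K1a line implies the K1a line of record (rate `a(1-t)`), hence the registered text of 3⁗ — by name -/

section HonestLine

/-- **THE HONEST K1a LINE FOR ONE CONSTANTS RECORD** (hypothesis schema, never asserted): the slack pen's `K1aLine L 𝔠 a₀ a₁ a` (p532839 §3) with its three
display-located rows read in the DISPLAYED currency — the kernel size row WITH the birth coupling and both runs (`KernelSizeΦg`), the configuration rows WITH
print's collar polylogarithm `r(g_b) = (1 + log g_b⁻¹)^{r₀}` of (7)/(28) at the record's exponent `𝔠.r₀` (`CfgSizeΦr`, `CfgCauchyΦr`); the other eight rows, the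
window and the coherent package VERBATIM. [cite: Balaban1985UV3, (7) p.257, (28) p.263, (34) p.264; King1986, Thm 3.4 (3.9) p.656, Prop. 3.6 p.662] -/
def K1aLineHonest (L : ℕ) (𝔠 : AlphaConsts L (suGroupModel 2).N) (a₀ a₁ a : ℝ) : Prop :=
  ∃ (κ C C_E C_R C_s C_B C_T C' γB : ℝ), 0 ≤ C ∧ 0 ≤ C_E ∧ 0 ≤ C_R ∧ 0 ≤ C_s ∧ 0 ≤ C_B ∧ 0 ≤ C_T ∧ 0 < γB ∧
    ∀ (F : T3Family) (γ : ℝ) (hF : F.L = L) (hγ : 0 < γ), γ ≤ γB → ∀ (hγ1 : γ ≤ (min (hF ▸ 𝔠).gamma0 1) ^ 2),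
      AlphaInputsT3AC.OfV3At F (hF ▸ 𝔠) a₀ a₁ →
        (∀ n, (C_s + C_B) * θBal F.L γ (hF ▸ 𝔠).b₀ (hF ▸ 𝔠).p₀ n ≤ 1) ∧
        ∃ (p : ∀ K, AlphaInputsT3AC.PkgAtV3 F (hF ▸ 𝔠) γ hγ hγ1 K), (∀ K, (p K).a₀ = a₀ ∧ (p K).a₁ = a₁) ∧
          ∃ (π : AlphaInputsT3AC.PolymerT3 F) (PT : TermFn F) (Φ : ChartFam ↥(lieC (suGroupModel 2)) F) (e : VacFam F)
            (B : CfgFam ↥(lieC (suGroupModel 2)) F) (R : RemFam F),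
            PintDecompTrivT (AlphaInputsT3AC.dataOfV3 p π) PT ∧ LocCover (AlphaInputsT3AC.dataOfV3 p π) κ C' ∧
            LocBlockVolume (AlphaInputsT3AC.dataOfV3 p π) ∧ LocMatched (AlphaInputsT3AC.dataOfV3 p π) ∧
            TermSizeTrivT (AlphaInputsT3AC.dataOfV3 p π) PT (hF ▸ 𝔠).b₀ (hF ▸ 𝔠).p₀ C_T κ ∧
            TaylorSplitΦ PT Φ e B R ∧ FlatKernelCauchyΦ (AlphaInputsT3AC.dataOfV3 p π) Φ κ a C ∧
            KernelSizeΦg (AlphaInputsT3AC.dataOfV3 p π) Φ κ C_E ∧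
            RemainderSmallΦ (AlphaInputsT3AC.dataOfV3 p π) R (hF ▸ 𝔠).b₀ (hF ▸ 𝔠).p₀ κ C_R ∧
            CfgSizeΦr (AlphaInputsT3AC.dataOfV3 p π) B (hF ▸ 𝔠).b₀ (hF ▸ 𝔠).p₀ (hF ▸ 𝔠).r₀ C_s ∧
            CfgCauchyΦr (AlphaInputsT3AC.dataOfV3 p π) B (hF ▸ 𝔠).b₀ (hF ▸ 𝔠).p₀ (hF ▸ 𝔠).r₀ a C_B fun _ => 1

/-- **THE HONEST LINE IMPLIES THE LINE OF RECORD** at rate `a(1-t)` (any `0 < t ≤ 1`): witness the record's chart family and configurations by the RESCALED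
pair `(Φ̃, B̃) = (Φ∘(λ•), λ⁻¹•B)`, `λ = r(g_b)` at the record's `r₀`; constants `C ↦ C^{1-t}(2C_E)^t·M(6r₀,t)`, `C_E ↦ C_E·M(6r₀,1)`, everything else verbatim.
[cite: Balaban1985UV3, (7) p.257, (28) p.263, (34) p.264; King1986, Prop. 3.6 (3.56) p.662, Prop. 3.9 (3.71) p.665] -/
theorem k1aLine_of_honest {L : ℕ} {𝔠 : AlphaConsts L (suGroupModel 2).N} {a₀ a₁ a t : ℝ} (ha : 0 ≤ a) (ht : 0 < t) (ht1 : t ≤ 1)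
    (h : K1aLineHonest L 𝔠 a₀ a₁ a) : K1aLine L 𝔠 a₀ a₁ (a * (1 - t)) := by
  obtain ⟨κ, C, C_E, C_R, C_s, C_B, C_T, C', γB, hC, hCE, hCR, hCs, hCB, hCT, hγB, hline⟩ := h
  have hr : 0 ≤ 𝔠.r₀ := le_trans zero_le_one 𝔠.one_le_r₀
  have hM1 : 0 ≤ logPowConst (6 * 𝔠.r₀) 1 := (logPowConst_pos (by nlinarith) one_pos).le
  have hMt : 0 ≤ logPowConst (6 * 𝔠.r₀) t := (logPowConst_pos (by nlinarith) ht).le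
  refine ⟨κ, C ^ (1 - t) * (2 * C_E) ^ t * logPowConst (6 * 𝔠.r₀) t, C_E * logPowConst (6 * 𝔠.r₀) 1, C_R, C_s, C_B, C_T, C', γB,
    mul_nonneg (mul_nonneg (Real.rpow_nonneg hC _) (Real.rpow_nonneg (by linarith) _)) hMt, mul_nonneg hCE hM1, hCR, hCs, hCB, hCT, hγB,
    fun F γ hF hγ hγle hγ1 hOf => ?_⟩
  subst hF
  obtain ⟨hwin, p, hp, π, PT, Φ, e, B, R, hdec, hLC, hBV, hLM, hTS, hT, hK, hE, hR, hS, hBC⟩ := hline F γ rfl hγ hγle hγ1 hOf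
  have hL : 1 ≤ F.L := F.hL.2.le
  have hγ1' : γ ≤ 1 := hγ1.trans (sq_min_one_le _ 𝔠.gamma0_pos)
  have hθ0 : ∀ n, 0 ≤ θBal F.L γ 𝔠.b₀ 𝔠.p₀ n := fun n =>
    (T3MinimiserStabilityReduction.θBal_pos hL hγ hγ1' 𝔠.b₀_pos 𝔠.p₀ n).le
  have hw0 : ∀ i, collarW F.L γ 𝔠.r₀ i ≠ 0 := fun i => (collarW_pos hL hγ hγ1' hr i).ne'
  have ha' : a * (1 - t) ≤ a := by nlinarith
  exact ⟨hwin, p, hp, π, PT, rescaleΦ (collarW F.L γ 𝔠.r₀) Φ, e, rescaleB (collarW F.L γ 𝔠.r₀) B, R, hdec, hLC, hBV, hLM, hTS,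
    taylorSplitΦ_rescale _ hw0 hT, flatKernelCauchyΦ_rescale hL hγ hγ1' hr hC hCE ht ht1 hK hE, kernelSizeΦ_rescale hL hγ hγ1' hr hCE hE, hR,
    cfgSizeΦ_rescale hL hγ hγ1' hr hS, cfgCauchyΦ_rate_mono hL hCB hθ0 (fun _ => zero_le_one) ha' (cfgCauchyΦ_rescale hL hγ hγ1' hr hBC)⟩

/-- **THE REGISTERED TEXT OF 3⁗ FROM THE HONEST K1a LINE, BY NAME** (`globalTwoRunSlackFam_of_k1aLine ∘ k1aLine_of_honest` at `t = ½`): if for every odd `L ≥ 7`,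
every constants record and [7]-constants there is a rate exponent `0 < a < 1` with `K1aLineHonest L 𝔠 a₀ a₁ a`, then the text of `stub_globalTwoRunSlackFam`
(skeleton v5j‴ `Cruxes/FluctuationComparisonRegPrL/Lines/birth_v5j3.lean` l.107–119) holds VERBATIM — σ = 7, profile `θBal(b₀,p₀)`, rate `a/2`; no letter of
record re-typed, no «r₀ letter», no profile letter, no β-door. [cite: King1986, Thm 3.4 (3.9) p.656, Prop. 3.6 p.662; Balaban1985UV3, (7) p.257, (28) p.263,
(34) p.264, (43)-(46) pp.266-267, (57) p.270] -/
theorem globalTwoRunSlackFam_of_k1aLineHonest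
    (h : ∀ (L : ℕ), Odd L → 7 ≤ L → ∀ (𝔠 : AlphaConsts L (suGroupModel 2).N) (a₀ a₁ : ℝ), 0 < a₀ → 0 < a₁ → 𝔠.B₃ * a₁ ≤ a₀ →
      ∃ a : ℝ, 0 < a ∧ a < 1 ∧ K1aLineHonest L 𝔠 a₀ a₁ a) :
    ∀ (L : ℕ), Odd L → 7 ≤ L → ∀ (𝔠 : Summit.QuantumFields.Balaban3D.Proofs.Primitives.AlphaConsts L (Summit.QuantumFields.Balaban3D.Carriers.suGroupModel 2).N)
      (a₀ a₁ : ℝ), 0 < a₀ → 0 < a₁ → 𝔠.B₃ * a₁ ≤ a₀ →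
      ∃ a : ℝ, 0 < a ∧ ∃ γB : ℝ, 0 < γB ∧ ∀ (F : T3Family) (γ : ℝ) (hF : F.L = L) (hγ : 0 < γ), γ ≤ γB →
        ∀ (hγ1 : γ ≤ (min (hF ▸ 𝔠).gamma0 1) ^ 2),
          Summit.QuantumFields.YangMills.Theorems.AlphaInputsT3AC.OfV3At F (hF ▸ 𝔠) a₀ a₁ →
          ∃ (p : ∀ K, Summit.QuantumFields.YangMills.Theorems.AlphaInputsT3AC.PkgAtV3 F (hF ▸ 𝔠) γ hγ hγ1 K),
            (∀ K, (p K).a₀ = a₀ ∧ (p K).a₁ = a₁) ∧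
            ∃ (π : Summit.QuantumFields.YangMills.Theorems.AlphaInputsT3AC.PolymerT3 F) (σ : ℕ) (C : ℝ), 7 ≤ σ ∧ 0 ≤ C ∧
              Summit.QuantumFields.YangMills.Theorems.GlobalSlack.GlobalSupRateTSlack (Summit.QuantumFields.YangMills.Theorems.AlphaInputsT3AC.dataOfV3 p π) (hF ▸ 𝔠).b₀ (hF ▸ 𝔠).p₀ a σ C :=
  globalTwoRunSlackFam_of_k1aLine fun L hLo h7 𝔠 a₀ a₁ ha0 ha1 hw => by
    obtain ⟨a, ha, ha1', hH⟩ := h L hLo h7 𝔠 a₀ a₁ ha0 ha1 hw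
    exact ⟨a * (1 - 1 / 2), by nlinarith, by nlinarith, k1aLine_of_honest ha.le one_half_pos (by norm_num) hH⟩

end HonestLine

end Summit.QuantumFields.YangMills.Theorems.GlobalSlackKernelRescale

end
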